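import Summits.Ventures.HSemireg.UntwistCocycleTwistLeibnizCocycle
import Summits.Ventures.HSemireg.UntwistCocycleTwistDualHomTrace
import Literature.AlgebraicGeometry.HodgeTheory.AtiyahClassCech
import Literature.AlgebraicGeometry.Modules.CechCup
import HarnessLib

/-!
# Venture HSemireg — route R1.0, untwisted reading: **the Leibniz rule for the Atiyah class along the
# cocycle twist**, `At(E ⊗ M) = (At(E) ⊗ 1_M) · λ + [e ↦ e ⊗ dlog g]`, on REAL carriers (gs-g4; sequel of
# `UntwistCocycleTwistLeibnizCocycle.lean`)

HONEST FRAMING. Module-level homological algebra on the tree's REAL carriers: Mathlib's `Abelian.Ext` in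
`X.Modules`, the real Atiyah class `HodgeTheory.atiyahClass E ∈ Ext¹(E, E ⊗ Ω¹)` (class of the jet sequence), the
Čech classes `Modules.Cech.classOf` of cocycles of local homomorphisms and the class formula for locally split
sequences (`Modules/CechClassOfLocallySplit.lean`), th-4's cocycle twist `- ⊗ M` (`M = lineBundle c`) and the
comparison `λ = CocycleTwist.dualHomTwist`. Nothing about any variety; no gerbe; nothing here says HC, HC_CM or
HC_AV is proved.

THE THEOREM (`atiyahClass_twist`). For an `S`-scheme `X`, a cocycle `c` and a finite locally free `E`:

  `At(E⟨c⟩) = θ(At(E)) · [λ_{Ω¹}] + [ν]`  in `Ext¹(E⟨c⟩, E⟨c⟩ ⊗ Ω¹)`,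

where `θ = - ⊗ M` on `Ext` (Mathlib `Ext.mapExactFunctor` of th-4's twist functor), `λ_{Ω¹} : (E ⊗ Ω¹)⟨c⟩ → E⟨c⟩ ⊗ Ω¹`
the comparison of `UntwistCocycleTwistDualHom.lean`, and `ν` the Čech `1`-cocycle of local homomorphisms
`e ↦ e ⊗ ω_{xy}`, `ω_{xy} = -g_{xy} d g_{yx} = dlog g_{xy}` (`twistScalarFamily`), on the cover
`W_x = (frame open of E at x) ∩ U_x` — Atiyah's `b(E ⊗ L) = b(E) ⊗ 1 + 1 ⊗ b(L)` with `b(L) = {dlog g_{xy}}`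
(Prop. 10, Prop. 12), in the only form the tree's carriers allow (no tensor product of Ext classes: the second
term stays a Čech class; its trace is computed in the sequel). SIGN BOOKKEEPING (th-1, as printed): Atiyah's
Prop. 12 represents `b(L)` by the cocycle `-d log g_{ij}` in HIS transition convention; here the transition law is
th-4's `s_x = g_{xy} s_y` and the scalar cochain is `ω_{xy} = -g_{xy} d g_{yx}`; no identification of `[ω]` with a
normalised `c₁(M)` is claimed or needed (the consumer only uses that the correction is a scalar class).

Proof: both `θ(At(E))` (class of the twisted jet sequence, `Ext.mapExactFunctor_extClass`) and `At(E⟨c⟩)` are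
classes of LOCALLY SPLIT sequences over `W_x` (sections transported from the frame sections of `P¹(E)`,
`UntwistCocycleTwistJet`), hence Čech classes of the difference cocycles of the splittings
(`Cech.classOf_splittingDifference`); the Leibniz cocycle identity of the previous file says
`δ^{E⟨c⟩} = δ^{θ} ≫ λ + ν` as cochains; `classOf` is additive and natural under post-composition
(`classOf_postcompFamily`, from `ExactAugmentation.theta_comp_map` along the Čech complex of `λ`).

Which Ext groups: `Ext¹(E⟨c⟩, E⟨c⟩ ⊗ Ω¹)` (the home of `At(E⟨c⟩)`); which class: `At`, `c₁(M) = [dlog g]`; which twist: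
`- ⊗ M_B`, `M_B = lineBundle c`.

## References

* M. F. Atiyah, *Complex analytic connections in fibre bundles*, Trans. AMS 85 (1957), §4, Prop. 10, Prop. 12.
  [Atiyah1957]
* R.-O. Buchweitz, H. Flenner, Compositio Math. 137 (2003), §3 (`At(F ⊗ L)`). [BuchweitzFlenner2003]
* R. Hartshorne, *Algebraic Geometry* (1977), III.4 (Čech cohomology), III Ex. 4.5. [Hartshorne1977]
-/

noncomputable section

open CategoryTheory CategoryTheory.Abelian AlgebraicGeometry Opposite TopologicalSpace Limits

namespace Summit.Ventures.HSemireg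

namespace CocycleTwist

open Literature.AlgebraicGeometry.Modules Literature.AlgebraicGeometry.Motives
  Literature.AlgebraicGeometry.HodgeTheory Literature.AlgebraicGeometry.Modules.Cech Literature.Algebra.Homology

universe u

/-! ### Čech classes are natural under post-composition with a morphism of coefficients -/

section CechPostcomp

variable {Y : Scheme.{u}} {ι : Type u} {U : ι → Y.Opens} {n : ℕ} {A M N : Y.Modules} (φ : M ⟶ N)

/-- The Čech differential commutes with `Čⁿ(φ)`. [folklore] -/
theorem cech_d_comp_map (n : ℕ) : Cech.d U M n ≫ Cech.map U (n + 1) M φ = Cech.map U n M φ ≫ Cech.d U N n := by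
  simp only [Cech.d, Preadditive.sum_comp, Preadditive.comp_sum, Preadditive.zsmul_comp, Preadditive.comp_zsmul,
    structMap_map]

variable (U) in
/-- **The Čech complex is functorial in the coefficients**: `Č•(𝓤, φ) : Č•(𝓤, M) ⟶ Č•(𝓤, N)`.
[cite: StacksProject, Tag 01ED] -/
def cechComplexMap : Cech.complex U M ⟶ Cech.complex U N where
  f n := Cech.map U n M φ
  comm' n m h := by
    cases h
    rw [complex_d, complex_d]
    exact (cech_d_comp_map φ n).symm

/-- Components of `Č•(𝓤, φ)`. [folklore] -/
@[simp]
theorem cechComplexMap_f (n : ℕ) : (cechComplexMap U φ).f n = Cech.map U n M φ := rfl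

/-- The augmentation is natural: `ε_M ≫ Č⁰(φ) = φ ≫ ε_N`. [folklore] -/
theorem augment_comp_map : augment U M ≫ Cech.map U 0 M φ = φ ≫ augment U N :=
  hom_ext_to fun V x α => by
    rw [Scheme.Modules.Hom.comp_app, CategoryTheory.comp_apply, map_app_apply, augment_app_apply,
      Scheme.Modules.Hom.comp_app, CategoryTheory.comp_apply, augment_app_apply, app_res]

/-- **Post-composition of a cochain of local homomorphisms with a morphism of coefficients**:
`(ω ≫ φ)_α = ω_α ≫ φ|`. [folklore] -/
def postcompFamily (ω : LocalFamily U n A M) (φ : M ⟶ N) : LocalFamily U n A N := fun α =>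
  ω α ≫ (SheafOfModules.overFunctor _ (face U α)).map φ

/-- `(ω ≫ φ)♯ = ω♯ ≫ Čⁿ(φ)`. [folklore] -/
theorem familyHom_postcompFamily (ω : LocalFamily U n A M) :
    familyHom (postcompFamily ω φ) = familyHom ω ≫ Cech.map U n M φ :=
  hom_ext_to fun V s α => by
    rw [familyHom_app_apply, Scheme.Modules.Hom.comp_app, CategoryTheory.comp_apply, map_app_apply,
      familyHom_app_apply, postcompFamily, appLE_comp, appLE_over_map]

/-- Post-composition preserves cocycles. [folklore] -/
theorem dFamily_postcompFamily_eq_zero (ω : LocalFamily U n A M) (hω : dFamily ω = 0) :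
    dFamily (postcompFamily ω φ) = 0 := by
  apply eq_zero_of_familyHom_eq_zero
  rw [← familyHom_comp_d, familyHom_postcompFamily, Category.assoc, ← cech_d_comp_map, ← Category.assoc,
    familyHom_comp_d, hω, familyHom_zero, zero_comp]

variable [HasExt.{u + 1} Y.Modules] (hU : iSup U = ⊤)

/-- **`[ω ≫ φ] = [ω] ∘ [φ]`**: the Čech class is natural under post-composition with a morphism of coefficients
(`ExactAugmentation.theta_comp_map` along `Č•(𝓤, φ)`). [cite: Hartshorne1977, III Lemma 4.4] -/
theorem classOf_postcompFamily (ω : LocalFamily U n A M) (hω : dFamily ω = 0) :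
    classOf (exactAugmentation U N hU) (postcompFamily ω φ) (dFamily_postcompFamily_eq_zero φ ω hω) =
      (classOf (exactAugmentation U M hU) ω hω).comp (Ext.mk₀ φ) (add_zero n) := by
  rw [classOf_def, classOf_def,
    ← ExactAugmentation.theta_comp_map (exactAugmentation U M hU) (exactAugmentation U N hU) (cechComplexMap U φ) φ
      (by exact augment_comp_map φ) (familyHom ω) (familyHom_comp_d_eq_zero ω hω)
      (ExactAugmentation.comp_f_d_eq_zero (cechComplexMap U φ) (familyHom ω) (familyHom_comp_d_eq_zero ω hω))]
  exact ExactAugmentation.theta_congr _ (by exact familyHom_postcompFamily φ ω) _ _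

end CechPostcomp

/-! ### The difference cocycle after the inclusion is the difference of the sections -/

section SplittingDifference

variable {Y : Scheme.{u}} {ι : Type u} {U : ι → Y.Opens} {T : ShortComplex Y.Modules} (σ : LocalSplittings U T)

/-- `f(δ_{ab}(x)) = s_a(x) - s_b(x)`: the difference cocycle followed by the inclusion is the difference of the
sections. [cite: Hartshorne1977, III.4 (proof of Thm. 4.5)] -/
theorem f_app_appLE_splittingDifference (β : Fin 2 → ι) {W : Y.Opens} (k : W ⟶ face U β) (x : Γ(T.X₃, W)) :
    T.f.app W (appLE (splittingDifference σ β) k x) =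
      appLE (Cech.sec σ (β 0)) (k ≫ homOfLE (face_le U β 0)) x -
        appLE (Cech.sec σ (β 1)) (k ≫ homOfLE (face_le U β 1)) x := by
  rw [appLE_splittingDifference, eq_sub_iff_add_eq]
  have h := f_app_appLE_r_add σ (β 1) (k ≫ homOfLE (face_le U β 1))
    (appLE (Cech.sec σ (β 0)) (k ≫ homOfLE (face_le U β 0)) x)
  rwa [g_app_appLE_s] at h

end SplittingDifference

/-! ### The cochain `e ↦ e ⊗ ω` of a cochain of `1`-forms -/

section TensorWith

variable {S : Type u} [CommRing S] {X : Over (Spec (CommRingCat.of S))} (F G : X.left.Modules) {W : X.left.Opens}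

/-- Post-composition with a LOCAL morphism on an internal Hom: `𝓗om(A, B)|_W ⟶ 𝓗om(A, B')|_W`, `ψ ↦ ψ ≫ t|`.
[folklore] -/
def postcompOver (A : X.left.Modules) {B B' : X.left.Modules} (t : B.over W ⟶ B'.over W) :
    (sheafHom A B).over W ⟶ (sheafHom A B').over W where
  val := PresheafOfModules.homMk
    { app := fun V => AddCommGrpCat.ofHom
        { toFun := fun (ψ : A.over V.unop.left ⟶ B.over V.unop.left) =>
            (ψ ≫ restrictHom V.unop.hom t : A.over V.unop.left ⟶ B'.over V.unop.left)
          map_zero' := zero_comp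
          map_add' := fun ψ ψ' => Preadditive.add_comp _ _ _ _ _ _ }
      naturality := fun {V V'} i => by
        refine AddCommGrpCat.ext fun (ψ : A.over V.unop.left ⟶ B.over V.unop.left) => ?_
        change restrictHom i.unop.left ψ ≫ restrictHom V'.unop.hom t = restrictHom i.unop.left (ψ ≫ restrictHom V.unop.hom t)
        rw [restrictHom_comp, ← restrictHom_comp', Subsingleton.elim (i.unop.left ≫ V.unop.hom) V'.unop.hom] }
    (fun V (a : Γ(X.left, V.unop.left)) (ψ : A.over V.unop.left ⟶ B.over V.unop.left) => by
      change (a • ψ) ≫ restrictHom V.unop.hom t = a • (ψ ≫ restrictHom V.unop.hom t)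
      rw [smul_comp_overHom])

/-- Values of `postcompOver t`. [folklore] -/
@[simp]
theorem appLE_postcompOver (A : X.left.Modules) {B B' : X.left.Modules} (t : B.over W ⟶ B'.over W) {V : X.left.Opens}
    (k : V ⟶ W) (ψ : A.over V ⟶ B.over V) :
    appLE (postcompOver A t) k (ψ : Γ(sheafHom A B, V)) = (ψ ≫ restrictHom k t : Γ(sheafHom A B', V)) := rfl

/-- **`e ↦ e ⊗ ω`**: the local morphism `F|_W ⟶ (F ⊗ G)|_W = 𝓗om(F^∨, G)|_W` determined by a section
`ω ∈ Γ(G, W)` (biduality `e ↦ (μ ↦ μ(e))` followed by multiplication by `ω`). [cite: Hartshorne1977, II Ex. 5.1 (b)] -/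
def tensorWith (ω : Γ(G, W)) : F.over W ⟶ (sheafHom (dual F) G).over W :=
  (SheafOfModules.overFunctor _ W).map (toBidual F (unitModule X.left)) ≫ postcompOver (dual F) (smulSection ω)

/-- Values of `tensorWith ω`: `e ↦ e ⊗ ω|`. [folklore] -/
theorem appLE_tensorWith (ω : Γ(G, W)) {V : X.left.Opens} (k : V ⟶ W) (e : Γ(F, V)) :
    appLE (tensorWith F G ω) k e = tensorForm F G e (G.presheaf.map k.op ω) := by
  rw [tensorWith, appLE_comp, appLE_over_map, toBidual_app_apply, appLE_postcompOver, restrictHom_smulSection]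
  rfl

end TensorWith

/-! ### The setting: a finite locally free `E`, the cover `W_x`, the two families of splittings -/

section Setting

variable {S : Type u} [CommRing S] {X : Over (Spec (CommRingCat.of S))} (c : UnitCocycle X.left)
  {E : X.left.Modules} (hE : IsFiniteLocallyFree E)

/-- **The cover `W_x = U^E_x ∩ U_x`**: the frame neighbourhood of `E` at `x` met with the member at `x` of the cover
of the cocycle. [folklore] -/
def leibnizCover (x : X.left) : X.left.Opens := trivNbhd hE x ⊓ c.U x

/-- `W_x ⊆ U_x`. [folklore] -/
theorem leibnizCover_le (x : X.left) : leibnizCover c hE x ≤ c.U x := inf_le_right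

/-- The `W_x` cover `X`. [folklore] -/
theorem iSup_leibnizCover : iSup (leibnizCover c hE) = ⊤ :=
  top_unique fun x _ => Opens.mem_iSup.2 ⟨x, mem_trivNbhd hE x, c.mem x⟩

/-- The frame section of `P¹(E) → E` over `W_x` (the chosen frame of `E` at `x`, restricted). [folklore] -/
def leibnizSection (x : X.left) : E.over (leibnizCover c hE x) ⟶ (jetModule E).over (leibnizCover c hE x) :=
  frameJetSection E (SheafOfModules.restrictTrivialisation (R := X.left.ringCatSheaf)
    (homOfLE (inf_le_left : leibnizCover c hE x ≤ trivNbhd hE x)) (trivFrame hE x))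

/-- The frame section is a section of `π`. [folklore] -/
theorem leibnizSection_comp_π (x : X.left) :
    leibnizSection c hE x ≫ (SheafOfModules.overFunctor _ _).map (jetπ E) = 𝟙 _ :=
  frameJetSection_comp_g E _

/-- The twisted jet sequence `0 → (E ⊗ Ω¹)⟨c⟩ → P¹(E)⟨c⟩ → E⟨c⟩ → 0` (image of the jet sequence under the exact
functor `- ⊗ M`). [folklore] -/
abbrev twistedJetShortComplex : ShortComplex X.left.Modules :=
  (jetShortComplex E).map (twistEquivalence X.left c).functor

/-- The twisted jet sequence is short exact. [folklore] -/
theorem twistedJetShortComplex_shortExact : (twistedJetShortComplex c (E := E)).ShortExact :=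
  (jetShortComplex_shortExact E).map_of_exact (twistEquivalence X.left c).functor

/-- **Local splittings of the twisted jet sequence** over `W_x`: the frame sections transported along `t_x`
(`jetSectionUntwist`). [folklore] -/
def twistedJetSplittings : LocalSplittings (leibnizCover c hE) (twistedJetShortComplex c (E := E)) := fun x =>
  localSplittingOfSection (twistedJetShortComplex_shortExact c) (leibnizCover c hE x)
    (jetSectionUntwist c E x _ (leibnizCover_le c hE x) (leibnizSection c hE x))
    (by
      exact jetSectionUntwist_comp_π c E x _ (leibnizCover_le c hE x) (leibnizSection c hE x)
        (leibnizSection_comp_π c hE x))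

/-- **Local splittings of the jet sequence of `E⟨c⟩`** over `W_x`: the frame sections transported along `t_x` and
`J_x` (`jetSectionTwist`). [folklore] -/
def jetTwistSplittings : LocalSplittings (leibnizCover c hE) (jetShortComplex (twist c E)) := fun x =>
  localSplittingOfSection (jetShortComplex_shortExact (twist c E)) (leibnizCover c hE x)
    (jetSectionTwist c E x _ (leibnizCover_le c hE x) (leibnizSection c hE x))
    (jetSectionTwist_comp_π c E x _ (leibnizCover_le c hE x) (leibnizSection c hE x) (leibnizSection_comp_π c hE x))

/-- The difference cocycle `δ^θ` of the splittings of the twisted jet sequence, typed on `E⟨c⟩ → (E ⊗ Ω¹)⟨c⟩`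
(the terms of the twisted sequence are these modules definitionally). [folklore] -/
def twistedJetDifference : LocalFamily (leibnizCover c hE) 1 (twist c E) (twist c (twistCotangent E)) :=
  splittingDifference (twistedJetSplittings c hE)

/-- `δ^θ` is a cocycle. [folklore] -/
theorem dFamily_twistedJetDifference : dFamily (twistedJetDifference c hE) = 0 :=
  dFamily_splittingDifference (twistedJetSplittings c hE)

/-- **The scalar cochain `ν`**: `e ↦ e ⊗ ω_{xy}`, `ω_{xy} = -g_{xy} d g_{yx}`, over `W_x ∩ W_y`. [cite: Atiyah1957, Prop. 12] -/
def twistScalarFamily : LocalFamily (leibnizCover c hE) 1 (twist c E) (twistCotangent (twist c E)) := fun β =>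
  tensorWith (twist c E) (cotangentSheaf X)
    (dlogForm c (β 0) (β 1) (face (leibnizCover c hE) β)
      ((face_le _ β 0).trans (leibnizCover_le c hE (β 0))) ((face_le _ β 1).trans (leibnizCover_le c hE (β 1))))

/-- `dlogForm` restricts. [folklore] -/
theorem map_dlogForm (x y : X.left) {V V' : X.left.Opens} (hx : V ≤ c.U x) (hy : V ≤ c.U y) (i : V' ⟶ V) :
    (cotangentSheaf X).presheaf.map i.op (dlogForm c x y V hx hy) =
      dlogForm c x y V' (i.le.trans hx) (i.le.trans hy) := by
  rw [dlogForm, dlogForm, map_neg, Scheme.Modules.map_smul, map_dSection]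
  congr 2
  · exact map_g_apply c x y hx hy i.le
  · exact congrArg _ (map_g_apply c y x hy hx i.le)

/-- `(𝓗om(E^∨, Ω¹) ⊗ M → E⟨c⟩ ⊗ Ω¹)`-valued inclusion: `ι⟨c⟩` has injective components (as `ι` has). [folklore] -/
theorem twistMap_jetι_app_injective (V : X.left.Opens) :
    Function.Injective ((twistMap c (jetι E)).app V) := fun s t h => twist_ext c _ fun w => by
  have hw := congrArg (fun r => comp c (jetModule E) r w) h
  simp only [comp_twistMap_app] at hw
  exact congrArg JetSections.snd hw

/-- `ι' : E⟨c⟩ ⊗ Ω¹ → P¹(E⟨c⟩)` has injective components. [folklore] -/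
theorem jetι_app_injective (F : X.left.Modules) (V : X.left.Opens) : Function.Injective ((jetι F).app V) :=
  fun _ _ h => congrArg JetSections.snd h

/-- The difference cocycle `δ'` of the splittings of the jet sequence of `E⟨c⟩` (typed on `E⟨c⟩ → E⟨c⟩ ⊗ Ω¹`).
[folklore] -/
def jetTwistDifference : LocalFamily (leibnizCover c hE) 1 (twist c E) (twistCotangent (twist c E)) :=
  splittingDifference (jetTwistSplittings c hE)

/-- `δ'` is a cocycle. [folklore] -/
theorem dFamily_jetTwistDifference : dFamily (jetTwistDifference c hE) = 0 :=
  dFamily_splittingDifference (jetTwistSplittings c hE)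

/-- `ι'(δ'_{xy}(e)) = ŝ_x(e) - ŝ_y(e)` for the splittings of the jet sequence of `E⟨c⟩`. [folklore] -/
theorem jetι_app_appLE_jetTwistDifference (β : Fin 2 → X.left) {V : X.left.Opens} (k : V ⟶ face (leibnizCover c hE) β)
    (e : Γ(twist c E, V)) :
    (jetι (twist c E)).app V (appLE (jetTwistDifference c hE β) k e) =
      appLE (jetSectionTwist c E (β 0) _ (leibnizCover_le c hE (β 0)) (leibnizSection c hE (β 0)))
          (k ≫ homOfLE (face_le _ β 0)) e -
        appLE (jetSectionTwist c E (β 1) _ (leibnizCover_le c hE (β 1)) (leibnizSection c hE (β 1)))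
          (k ≫ homOfLE (face_le _ β 1)) e :=
  f_app_appLE_splittingDifference (jetTwistSplittings c hE) β k e

/-- `ι⟨c⟩(δ^θ_{xy}(e)) = s̃_x(e) - s̃_y(e)` for the splittings of the twisted jet sequence. [folklore] -/
theorem twistMap_jetι_app_appLE_twistedJetDifference (β : Fin 2 → X.left) {V : X.left.Opens}
    (k : V ⟶ face (leibnizCover c hE) β) (e : Γ(twist c E, V)) :
    (twistMap c (jetι E)).app V (appLE (twistedJetDifference c hE β) k e) =
      appLE (jetSectionUntwist c E (β 0) _ (leibnizCover_le c hE (β 0)) (leibnizSection c hE (β 0)))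
          (k ≫ homOfLE (face_le _ β 0)) e -
        appLE (jetSectionUntwist c E (β 1) _ (leibnizCover_le c hE (β 1)) (leibnizSection c hE (β 1)))
          (k ≫ homOfLE (face_le _ β 1)) e :=
  f_app_appLE_splittingDifference (twistedJetSplittings c hE) β k e

/-- **`δ^θ_{xy}(e) = D_{xy}(e) ⊗ t_x`**: the difference cocycle of the splittings of the twisted jet sequence is the
twist of the `E`-side difference form. [folklore] -/
theorem appLE_twistedJetDifference (β : Fin 2 → X.left) {V : X.left.Opens} (k : V ⟶ face (leibnizCover c hE) β)
    (e : Γ(twist c E, V)) :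
    appLE (twistedJetDifference c hE β) k e =
      trivSection c (twistCotangent E) (β 0) ((k ≫ homOfLE (face_le _ β 0)).le.trans (leibnizCover_le c hE (β 0)))
        (diffForm c E (leibnizCover_le c hE (β 0)) (leibnizSection c hE (β 0)) (leibnizSection c hE (β 1))
          (k ≫ homOfLE (face_le _ β 0)) (k ≫ homOfLE (face_le _ β 1)) e) := by
  apply twistMap_jetι_app_injective c V
  rw [twistMap_jetι_app_appLE_twistedJetDifference]
  exact appLE_jetSectionUntwist_sub c E _ _ _ _ _ _ e (leibnizSection_comp_π c hE (β 0))
    (leibnizSection_comp_π c hE (β 1))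

/-- **The Leibniz cochain identity, pointwise**: `δ'_{xy}(e) = λ(δ^θ_{xy}(e)) + e ⊗ ω_{xy}`.
[cite: Atiyah1957, §4 and Prop. 12] -/
theorem appLE_jetTwistDifference (β : Fin 2 → X.left) {V : X.left.Opens} (k : V ⟶ face (leibnizCover c hE) β)
    (e : Γ(twist c E, V)) :
    appLE (jetTwistDifference c hE β) k e =
      (dualHomTwist c E (cotangentSheaf X)).app V (appLE (twistedJetDifference c hE β) k e) +
        tensorForm (twist c E) (cotangentSheaf X) e
          (dlogForm c (β 0) (β 1) V ((k ≫ homOfLE (face_le _ β 0)).le.trans (leibnizCover_le c hE (β 0)))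
            ((k ≫ homOfLE (face_le _ β 1)).le.trans (leibnizCover_le c hE (β 1)))) := by
  apply jetι_app_injective (twist c E) V
  rw [jetι_app_appLE_jetTwistDifference, appLE_twistedJetDifference]
  exact appLE_jetSectionTwist_sub c E _ _ _ _ _ _ e (leibnizSection_comp_π c hE (β 0))
    (leibnizSection_comp_π c hE (β 1))

/-- **The Leibniz cochain identity**: the difference cocycle of the splittings of the jet sequence of `E⟨c⟩` is
`λ ∘` (the difference cocycle of the splittings of the twisted jet sequence) `+ ν`.
[cite: Atiyah1957, §4 and Prop. 12] -/
theorem jetTwistDifference_eq :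
    jetTwistDifference c hE =
      postcompFamily (twistedJetDifference c hE) (dualHomTwist c E (cotangentSheaf X)) + twistScalarFamily c hE := by
  funext β
  refine hom_ext_of_appLE fun V k e => ?_
  rw [appLE_jetTwistDifference, Pi.add_apply, appLE_add, postcompFamily, appLE_comp, appLE_over_map, twistScalarFamily,
    appLE_tensorWith, map_dlogForm]

/-- `ν` is a cocycle (it is the difference of two cocycles). [folklore] -/
theorem dFamily_twistScalarFamily : dFamily (twistScalarFamily c hE) = 0 := by
  have h := congrArg dFamily (jetTwistDifference_eq c hE)
  rw [dFamily_jetTwistDifference, dFamily_add,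
    dFamily_postcompFamily_eq_zero _ _ (dFamily_twistedJetDifference c hE), zero_add] at h
  exact h.symm

variable [HasExt.{u + 1} X.left.Modules]

/-- **The main term `θ(At(E)) · [λ_{Ω¹}]`** of `At(E⟨c⟩)`, typed on `Ext¹(E⟨c⟩, E⟨c⟩ ⊗ Ω¹)` (the twist functor's
object `(- ⊗ M)(E)` is `E⟨c⟩` definitionally). [folklore] -/
def atiyahClassTwistMain : Ext.{u + 1} (twist c E) (twistCotangent (twist c E)) 1 :=
  ((twistEquivalence X.left c).functor.mapExtAddHom E (twistCotangent E) 1 (atiyahClass E)).comp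
    (Ext.mk₀ (dualHomTwistObj c E (cotangentSheaf X))) (add_zero 1)

/-- Unfolding the main term. [folklore] -/
theorem atiyahClassTwistMain_def : atiyahClassTwistMain c (E := E) =
    ((twistEquivalence X.left c).functor.mapExtAddHom E (twistCotangent E) 1 (atiyahClass E)).comp
      (Ext.mk₀ (dualHomTwistObj c E (cotangentSheaf X))) (add_zero 1) := rfl

/-- **The Leibniz rule for the Atiyah class along `- ⊗ M`** (Atiyah 1957 Prop. 10 with Prop. 12, on the tree's
real carriers): `At(E⟨c⟩) = θ(At(E)) · [λ_{Ω¹}] + [ν]` in `Ext¹(E⟨c⟩, E⟨c⟩ ⊗ Ω¹)`, where `θ = - ⊗ M` on `Ext`,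
`λ_{Ω¹} : (E ⊗ Ω¹) ⊗ M → (E ⊗ M) ⊗ Ω¹` the comparison, and `[ν]` the Čech class of `e ↦ e ⊗ dlog g_{xy}` on the cover
`W_x` (the term `1_E ⊗ At(M)`, `At(M) = c₁(M) = [dlog g]`). [cite: Atiyah1957, Prop. 10 and Prop. 12; BuchweitzFlenner2003, §3] -/
theorem atiyahClass_twist :
    atiyahClass (twist c E) =
      atiyahClassTwistMain c (E := E) +
        classOf (exactAugmentation (leibnizCover c hE) _ (iSup_leibnizCover c hE)) (twistScalarFamily c hE)
          (dFamily_twistScalarFamily c hE) := by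
  have hJ : classOf (exactAugmentation (leibnizCover c hE) (twistCotangent (twist c E)) (iSup_leibnizCover c hE))
      (jetTwistDifference c hE) (dFamily_jetTwistDifference c hE) = atiyahClass (twist c E) :=
    classOf_splittingDifference_exactAugmentation (jetTwistSplittings c hE)
      (jetShortComplex_shortExact (twist c E)) (iSup_leibnizCover c hE)
  have hT : classOf (exactAugmentation (leibnizCover c hE) (twist c (twistCotangent E)) (iSup_leibnizCover c hE))
      (twistedJetDifference c hE) (dFamily_twistedJetDifference c hE) =
      (twistEquivalence X.left c).functor.mapExtAddHom E (twistCotangent E) 1 (atiyahClass E) :=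
    (classOf_splittingDifference_exactAugmentation (twistedJetSplittings c hE)
      (twistedJetShortComplex_shortExact c) (iSup_leibnizCover c hE)).trans
      (Ext.mapExactFunctor_extClass (twistEquivalence X.left c).functor (jetShortComplex_shortExact E)).symm
  rw [← hJ, classOf_congr _ (jetTwistDifference_eq c hE) _
      (by rw [← jetTwistDifference_eq c hE]; exact dFamily_jetTwistDifference c hE),
    classOf_add _ _ _ (dFamily_postcompFamily_eq_zero _ _ (dFamily_twistedJetDifference c hE))
      (dFamily_twistScalarFamily c hE),
    classOf_postcompFamily (dualHomTwist c E (cotangentSheaf X)) (iSup_leibnizCover c hE) (twistedJetDifference c hE)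
      (dFamily_twistedJetDifference c hE), hT]
  rfl

end Setting

end CocycleTwist

end Summit.Ventures.HSemireg

end
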